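import Mathlib
import HarnessLib
import Summits.Ventures.LatticeQCDFlow.Exactness.SphereLuscherSeriesSolver
import Summits.Ventures.LatticeQCDFlow.Exactness.SphereNNLOFlowSource

/-!
# The order-`t²` flow action of the lattice CP(N−1)/O(N) model: `S̃⁽²⁾ := q₆(𝔏₀) R⁽²⁾`, a lattice polynomial of degree `≤ 6`, solves Lüscher's order-`t²` equation with the closed-form source `R⁽²⁾` of `SphereNNLOFlowSource`

HONEST FRAMING: exact (Metropolis-corrected) sampling algorithms for lattice gauge theory;
figures of merit are autocorrelation/cost numbers at stated couplings and volumes; no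
continuum-physics claim.

Venture `LatticeQCDFlow` (cell pub-lqcd), topic `Exactness`; FANOUT row 7 (`s0-cpn-null`: the
S0-D1 rung — 2D CP⁹, Lüscher's LO trivializing map inside HMC, Engel–Schaefer 2011).  NEW WORK of
the cell over the tree's `Exactness/SphereLuscherSeriesSolver.lean` (the universal solver
polynomial `solverPoly`, `solverPoly_solves`), `Exactness/SphereNLOFlowAction.lean` (the NLO action
`S̃⁽¹⁾ = nloFlowAction` in closed form), `Exactness/SphereNNLOFlowSource.lean` (the order-`t²` source
`−Σ_k ⟪∂̃_k S, ∂̃_k S̃⁽¹⁾⟫` in closed form), `Exactness/SphereLuscherSeriesExistence.lean` (the carré du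
champ is graded) and `Exactness/SphereLatticeLuscherKernel.lean` (uniqueness up to constants);
nothing is cited as a fact.  Printed counterpart, NAMED ONLY: M. Lüscher, Commun. Math. Phys. 293
(2010) 899, §3.2 eqs. (3.9)–(3.12) and §4.3 eq. (4.14) (order `t²`: `−ΔS̃⁽²⁾ + ∂S·∂S̃⁽¹⁾ = Ċ⁽²⁾`);
Engel–Schaefer, Comput. Phys. Commun. 182 (2011) 2107, §3 (order `0` only); the order-2 action for
O(3) with unit couplings is printed (by hand, harmonic projections) in Chamness–Kovner–Orginos,
PoS LATTICE2023 008 — here the general-`d`, general-coupling object is produced by the universal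
polynomial `q₆` of `SphereLuscherSeriesSolver`, not by projections.

## Content (`E` finite-dimensional, `d = dim E ≥ 2`; couplings `U`; `Ω = S(E)^Λ`)

* `inner_clm_clm_mem_polyS` (`x ↦ ⟪A (x p), B (x q)⟫ ∈ polyS 2`), `stapleTerm/crossTerm/squareTerm
  _mem_polyS`, **`nloFlowAction_mem_polyS`** (`S̃⁽¹⁾ ∈ polyS 4`), **`nnloSource_mem_polyS`**
  (`R⁽²⁾ := −latticeCarre S S̃⁽¹⁾ ∈ polyS 6`).
* **`nnloFlowAction κ S₀ U := q₆(𝔏) R⁽²⁾`** (a member of `polyS 6`); **`nnlo_equation_solver`** — IT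
  SOLVES LÜSCHER'S ORDER-`t²` EQUATION: `−Σ_k ∂̃_k·∂̃_k S̃⁽²⁾ + Σ_k ⟪∂̃_k S, ∂̃_k S̃⁽¹⁾⟫ = ċ₂` on the
  product of unit spheres; **`nnlo_equation_solver_closed`** — the same with the source written in
  the closed form of `SphereNNLOFlowSource.nnlo_source_eq` (no self-coupling, adjoint pairs);
  **`nnloFlowAction_unique`** — every `C²` solution of the order-`t²` equation (any constant) differs
  from `S̃⁽²⁾` by a constant on `Ω`.

NOT CLAIMED: the monomial expansion of `S̃⁽²⁾` (it is determined, of degree `≤ 6`, but not expanded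
here); comparison with the printed O(3) coefficients; anything at flow time `t > 0` or numerical.
-/

noncomputable section

namespace Summit.Ventures.LatticeQCDFlow.Exactness

open Function Set Metric MeasureTheory Polynomial
open scoped RealInnerProductSpace

variable {Λ : Type*} {E : Type*} [NormedAddCommGroup E] [InnerProductSpace ℝ E]
  [FiniteDimensional ℝ E]

/-! ## §1 The NLO action and the order-`t²` source are lattice polynomials -/

section Degrees

/-- **A pairing of two transported site variables is a lattice polynomial of degree `2`**:
`x ↦ ⟪A (x p), B (x q)⟫ ∈ polyS 2` (expand in the frame; adjoints move `A`, `B` onto the frame). -/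
theorem inner_clm_clm_mem_polyS (A B : E →L[ℝ] E) (p q : Λ) :
    (fun x : Λ → E => ⟪A (x p), B (x q)⟫) ∈ polyS Λ E 2 := by
  set b := stdOrthonormalBasis ℝ E
  have e : (fun x : Λ → E => ⟪A (x p), B (x q)⟫) =
      ∑ i, ((fun x : Λ → E => ⟪ContinuousLinearMap.adjoint A (b i), x p⟫) *
        fun x : Λ → E => ⟪ContinuousLinearMap.adjoint B (b i), x q⟫) := by
    funext x
    simp only [Finset.sum_apply, Pi.mul_apply, ContinuousLinearMap.adjoint_inner_left]
    rw [← b.sum_inner_mul_inner (A (x p)) (B (x q))]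
    exact Finset.sum_congr rfl fun i _ => by rw [real_inner_comm (b i)]
  rw [e]
  exact Submodule.sum_mem _ fun i _ =>
    mul_mem_polyS_of_le (a := 1) (b := 1) le_rfl (slin_mem_polyS le_rfl _ _)
      (slin_mem_polyS le_rfl _ _)

variable (U : Λ → Λ → (E →L[ℝ] E))

/-- `x ↦ ⟪U n m (x m), x n⟫ ∈ polyS 2`. -/
theorem inner_coupling_self_mem_polyS (n m : Λ) :
    (fun x : Λ → E => ⟪U n m (x m), x n⟫) ∈ polyS Λ E 2 := by
  have e : (fun x : Λ → E => ⟪U n m (x m), x n⟫) =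
      fun x => ⟪U n m (x m), (ContinuousLinearMap.id ℝ E) (x n)⟫ := by
    funext x; simp
  rw [e]; exact inner_clm_clm_mem_polyS _ _ _ _

/-- `squareTerm U n m ∈ polyS 4`. -/
theorem squareTerm_mem_polyS (n m : Λ) : squareTerm U n m ∈ polyS Λ E 4 := by
  have e : squareTerm U n m = (fun x => ⟪U n m (x m), x n⟫) * fun x => ⟪U n m (x m), x n⟫ := by
    funext x; simp [squareTerm]
  rw [e]
  exact mul_mem_polyS_of_le (a := 2) (b := 2) le_rfl (inner_coupling_self_mem_polyS U n m)
    (inner_coupling_self_mem_polyS U n m)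

variable [DecidableEq Λ]

/-- `stapleTerm U n m m' ∈ polyS 2`. -/
theorem stapleTerm_mem_polyS (n m m' : Λ) : stapleTerm U n m m' ∈ polyS Λ E 2 := by
  by_cases h : m = m'
  · have e : stapleTerm U n m m' = fun _ => (0 : ℝ) := by funext x; simp [stapleTerm, h]
    rw [e]; exact const_mem_polyS 2 0
  · have e : stapleTerm U n m m' = fun x => ⟪U n m (x m), U n m' (x m')⟫ := by
      funext x; simp [stapleTerm, h]
    rw [e]; exact inner_clm_clm_mem_polyS _ _ _ _

/-- `crossTerm U n m m' ∈ polyS 4`. -/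
theorem crossTerm_mem_polyS (n m m' : Λ) : crossTerm U n m m' ∈ polyS Λ E 4 := by
  by_cases h : m = m'
  · have e : crossTerm U n m m' = fun _ => (0 : ℝ) := by funext x; simp [crossTerm, h]
    rw [e]; exact const_mem_polyS 4 0
  · have e : crossTerm U n m m' = (fun x => ⟪U n m (x m), x n⟫) * fun x => ⟪U n m' (x m'), x n⟫ := by
      funext x; simp [crossTerm, h]
    rw [e]
    exact mul_mem_polyS_of_le (a := 2) (b := 2) le_rfl (inner_coupling_self_mem_polyS U n m)
      (inner_coupling_self_mem_polyS U n m')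

variable [Fintype Λ]

/-- **`S̃⁽¹⁾ = nloFlowAction κ U ∈ polyS 4`** (the NLO action is a quartic lattice polynomial). -/
theorem nloFlowAction_mem_polyS (κ : ℝ) : nloFlowAction κ U ∈ polyS Λ E 4 := by
  have hA : stapleSum U ∈ polyS Λ E 4 := by
    have e : stapleSum U = ∑ n, ∑ m, ∑ m', stapleTerm U n m m' := by
      funext x; simp only [stapleSum, Finset.sum_apply]
    rw [e]
    exact Submodule.sum_mem _ fun n _ => Submodule.sum_mem _ fun m _ =>
      Submodule.sum_mem _ fun m' _ => polyS_mono (by norm_num) (stapleTerm_mem_polyS U n m m')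
  have hB : crossSum U ∈ polyS Λ E 4 := by
    have e : crossSum U = ∑ n, ∑ m, ∑ m', crossTerm U n m m' := by
      funext x; simp only [crossSum, Finset.sum_apply]
    rw [e]
    exact Submodule.sum_mem _ fun n _ => Submodule.sum_mem _ fun m _ =>
      Submodule.sum_mem _ fun m' _ => crossTerm_mem_polyS U n m m'
  have hC : squareSum U ∈ polyS Λ E 4 := by
    have e : squareSum U = ∑ n, ∑ m, squareTerm U n m := by
      funext x; simp only [squareSum, Finset.sum_apply]
    rw [e]
    exact Submodule.sum_mem _ fun n _ => Submodule.sum_mem _ fun m _ => squareTerm_mem_polyS U n m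
  have e : nloFlowAction κ U =
      (-(2 * κ ^ 2 / ((Module.finrank ℝ E : ℝ) - 1))) •
        ((2 * (Module.finrank ℝ E : ℝ) - 1)⁻¹ • stapleSum U -
          (2 * (2 * (Module.finrank ℝ E : ℝ) - 1))⁻¹ • crossSum U -
            (4 * (Module.finrank ℝ E : ℝ))⁻¹ • squareSum U) := by
    funext x
    simp only [nloFlowAction, nloPotential, Pi.smul_apply, Pi.sub_apply, smul_eq_mul]
  rw [e]
  exact Submodule.smul_mem _ _ (Submodule.sub_mem _ (Submodule.sub_mem _
    (Submodule.smul_mem _ _ hA) (Submodule.smul_mem _ _ hB)) (Submodule.smul_mem _ _ hC))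

/-- **The order-`t²` source `R⁽²⁾ = −latticeCarre S S̃⁽¹⁾`** (on the spheres:
`−Σ_k ⟪∂̃_k S, ∂̃_k S̃⁽¹⁾⟫`, `SphereLuscherSeriesExistence.sum_inner_siteGrad_eq_latticeCarre`). -/
def nnloSource (κ S₀ : ℝ) (U : Λ → Λ → (E →L[ℝ] E)) : (Λ → E) → ℝ :=
  fun x => -latticeCarre (esAction κ S₀ U) (nloFlowAction κ U) x

/-- **`R⁽²⁾ ∈ polyS 6`** (carré du champ of a quadratic and a quartic polynomial). -/
theorem nnloSource_mem_polyS (κ S₀ : ℝ) : nnloSource κ S₀ U ∈ polyS Λ E 6 :=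
  neg_latticeCarre_mem_polyS (a := 2) (m := 4) (esAction_mem_polyS κ S₀ U)
    (nloFlowAction_mem_polyS U κ)

end Degrees

/-! ## §2 `S̃⁽²⁾ := q₆(𝔏) R⁽²⁾` solves the order-`t²` equation -/

section OrderTwo

variable [Fintype Λ] [DecidableEq Λ] [MeasurableSpace E] [BorelSpace E] (U : Λ → Λ → (E →L[ℝ] E))

/-- **THE ORDER-`t²` FLOW ACTION OF THE LATTICE CP(N−1)/O(N) MODEL**: `S̃⁽²⁾ := q₆(𝔏) R⁽²⁾`, the
universal solver polynomial of degree-`6` lattice polynomials applied to the order-`t²` source — a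
lattice polynomial of degree `≤ 6` in the real site coordinates (general `d`, general couplings). -/
def nnloFlowAction (κ S₀ : ℝ) (U : Λ → Λ → (E →L[ℝ] E)) : polyS Λ E 6 :=
  aeval (polyLap Λ E 6) (solverPoly Λ E 6) ⟨nnloSource κ S₀ U, nnloSource_mem_polyS U κ S₀⟩

/-- **`S̃⁽²⁾` SOLVES LÜSCHER'S ORDER-`t²` EQUATION**: on the product of unit spheres,
`−Σ_k ∂̃_k·∂̃_k S̃⁽²⁾ + Σ_k ⟪∂̃_k S, ∂̃_k S̃⁽¹⁾⟫ = ċ₂` for a constant `ċ₂` (`dim E ≥ 2`). -/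
theorem nnlo_equation_solver (h2 : 2 ≤ Module.finrank ℝ E) (κ S₀ : ℝ) :
    ∃ c : ℝ, ∀ ξ : Λ → sphere (0 : E) 1,
      -∑ k, siteLaplacian k (nnloFlowAction κ S₀ U : (Λ → E) → ℝ) (fun n => (ξ n : E)) +
          ∑ k, ⟪siteGrad k (esAction κ S₀ U) (fun n => (ξ n : E)),
            siteGrad k (nloFlowAction κ U) (fun n => (ξ n : E))⟫ = c := by
  obtain ⟨c, hc⟩ := solverPoly_solves (Λ := Λ) (E := E) h2
    (⟨nnloSource κ S₀ U, nnloSource_mem_polyS U κ S₀⟩ : polyS Λ E 6)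
  refine ⟨c, fun ξ => ?_⟩
  have h := hc ξ
  have hs : nnloSource κ S₀ U (fun n => (ξ n : E)) =
      -∑ k, ⟪siteGrad k (esAction κ S₀ U) (fun n => (ξ n : E)),
        siteGrad k (nloFlowAction κ U) (fun n => (ξ n : E))⟫ := by
    rw [nnloSource, sum_inner_siteGrad_eq_latticeCarre (contDiff_of_mem_polyS (esAction_mem_polyS κ S₀ U))
      (contDiff_of_mem_polyS (nloFlowAction_mem_polyS U κ)) fun n => by simp]
  change -∑ k, siteLaplacian k (nnloFlowAction κ S₀ U : (Λ → E) → ℝ) (fun n => (ξ n : E)) =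
    nnloSource κ S₀ U (fun n => (ξ n : E)) + c at h
  rw [h, hs]
  ring

/-- **The same equation with the source in closed form** (`SphereNNLOFlowSource.nnlo_source_eq`:
no self-coupling, adjoint-pair couplings; `p_k = P_{x_k} J_k`, `V_A, V_B, V_C` the transported
local fields): `−Σ_k ∂̃_k·∂̃_k S̃⁽²⁾ = −(4κ³/(d−1)) Σ_k [(2/(2d−1))⟪p_k, V_A(k)⟫ −
(1/(2d−1))⟪p_k, V_B(k)⟫ − (1/d)⟪p_k, V_C(k)⟫] + ċ₂`. -/
theorem nnlo_equation_solver_closed (hU0 : ∀ n, U n n = 0)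
    (hUadj : ∀ m n (v w : E), ⟪U m n v, w⟫ = ⟪v, U n m w⟫) (h2 : 2 ≤ Module.finrank ℝ E)
    (κ S₀ : ℝ) : ∃ c : ℝ, ∀ ξ : Λ → sphere (0 : E) 1,
      -∑ k, siteLaplacian k (nnloFlowAction κ S₀ U : (Λ → E) → ℝ) (fun n => (ξ n : E)) =
        -(4 * κ ^ 3 / ((Module.finrank ℝ E : ℝ) - 1)) * ∑ k,
          ((2 / (2 * (Module.finrank ℝ E : ℝ) - 1)) *
              ⟪tangentKick (localField U k (fun n => (ξ n : E))) (ξ k : E),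
                ∑ n, U k n (localField U n (fun n => (ξ n : E)) - U n k (ξ k : E))⟫ -
            (1 / (2 * (Module.finrank ℝ E : ℝ) - 1)) *
              ⟪tangentKick (localField U k (fun n => (ξ n : E))) (ξ k : E),
                ⟪localField U k (fun n => (ξ n : E)), (ξ k : E)⟫ • localField U k (fun n => (ξ n : E)) -
                  ∑ m, ⟪U k m (ξ m : E), (ξ k : E)⟫ • U k m (ξ m : E) +
                  ∑ n, (⟪localField U n (fun n => (ξ n : E)), (ξ n : E)⟫ - ⟪U n k (ξ k : E), (ξ n : E)⟫) •
                    U k n (ξ n : E)⟫ -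
            (1 / (Module.finrank ℝ E : ℝ)) *
              ⟪tangentKick (localField U k (fun n => (ξ n : E))) (ξ k : E),
                ∑ m, ⟪U k m (ξ m : E), (ξ k : E)⟫ • U k m (ξ m : E)⟫) + c := by
  obtain ⟨c, hc⟩ := nnlo_equation_solver U h2 κ S₀
  refine ⟨c, fun ξ => ?_⟩
  have h := hc ξ
  have hsrc := nnlo_source_eq (U := U) hU0 hUadj h2 κ S₀ (x := fun n => (ξ n : E)) fun n => by simp
  rw [← hsrc]
  linarith

/-- **UNIQUENESS**: every `C²` functional satisfying the order-`t²` equation with SOME constant differs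
from `S̃⁽²⁾` by a constant on the product of unit spheres (`dim E ≥ 2`). -/
theorem nnloFlowAction_unique (h2 : 2 ≤ Module.finrank ℝ E) (κ S₀ : ℝ) {X : (Λ → E) → ℝ}
    (hX : ContDiff ℝ 2 X) {c' : ℝ}
    (h : ∀ ξ : Λ → sphere (0 : E) 1,
      -∑ k, siteLaplacian k X (fun n => (ξ n : E)) +
          ∑ k, ⟪siteGrad k (esAction κ S₀ U) (fun n => (ξ n : E)),
            siteGrad k (nloFlowAction κ U) (fun n => (ξ n : E))⟫ = c') :
    ∀ ξ ξ' : Λ → sphere (0 : E) 1,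
      X (fun n => (ξ n : E)) - (nnloFlowAction κ S₀ U : (Λ → E) → ℝ) (fun n => (ξ n : E)) =
        X (fun n => (ξ' n : E)) - (nnloFlowAction κ S₀ U : (Λ → E) → ℝ) (fun n => (ξ' n : E)) := by
  obtain ⟨c, hc⟩ := nnlo_equation_solver U h2 κ S₀
  have hR : ∀ ξ : Λ → sphere (0 : E) 1,
      -∑ k, siteLaplacian k X (fun n => (ξ n : E)) =
        nnloSource κ S₀ U (fun n => (ξ n : E)) + c' := fun ξ => by
    have hs : nnloSource κ S₀ U (fun n => (ξ n : E)) =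
        -∑ k, ⟪siteGrad k (esAction κ S₀ U) (fun n => (ξ n : E)),
          siteGrad k (nloFlowAction κ U) (fun n => (ξ n : E))⟫ := by
      rw [nnloSource, sum_inner_siteGrad_eq_latticeCarre
        (contDiff_of_mem_polyS (esAction_mem_polyS κ S₀ U))
        (contDiff_of_mem_polyS (nloFlowAction_mem_polyS U κ)) fun n => by simp]
    rw [hs]; linarith [h ξ]
  have hS : ∀ ξ : Λ → sphere (0 : E) 1,
      -∑ k, siteLaplacian k (nnloFlowAction κ S₀ U : (Λ → E) → ℝ) (fun n => (ξ n : E)) =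
        nnloSource κ S₀ U (fun n => (ξ n : E)) + c := fun ξ => by
    have hs : nnloSource κ S₀ U (fun n => (ξ n : E)) =
        -∑ k, ⟪siteGrad k (esAction κ S₀ U) (fun n => (ξ n : E)),
          siteGrad k (nloFlowAction κ U) (fun n => (ξ n : E))⟫ := by
      rw [nnloSource, sum_inner_siteGrad_eq_latticeCarre
        (contDiff_of_mem_polyS (esAction_mem_polyS κ S₀ U))
        (contDiff_of_mem_polyS (nloFlowAction_mem_polyS U κ)) fun n => by simp]
    rw [hs]; linarith [hc ξ]
  exact (luscher_poisson_unique h2 hX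
    (polyS_contDiff_two 6 _ (nnloFlowAction κ S₀ U).2) hR hS).2

end OrderTwo

end Summit.Ventures.LatticeQCDFlow.Exactness

end
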